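import Summits.QuantumAdvantage.AdviceFreeQNC0.LightDeviation
import Summits.QuantumAdvantage.AdviceFreeQNC0.TensorLPNorm
import Summits.QuantumAdvantage.AdviceFreeQNC0.TensorBlocksFixed
import HarnessLib

/-!
# Cell qa-qnc0 (rung F-Q1, density axis, crux of record `TensorMultOneAt` = MULT₁): the mass inequality
# at EVERY LEVEL (Sketch13 v6b/v6e statements VERBATIM) and `DomPays` — disjoint domination certificates
# imply `MassIneqK m k K0` for every `k` (planner qa-qnc0-p1 ROUND-12 §2.10 (xi-i), (xi-q); ask P18‴)

Planner qa-qnc0-p1 gen 13, `HOME/qa-qnc0-p1/Sketch13.lean` v6b (§MassInequalityK) and v6e (§Domination);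
the v6 vocabulary (`pwt`, `pdist`, `IsElim1`, `IsOpt1`, …) is qn-lit's `LightDeviation.lean`, namespace
`Summit.QuantumAdvantage.AdviceFreeQNC0.MassInequality`, which the statements below join.  Level `k+1`
of the tensor tower in dual normal form: a block-1 column map `v ↦ P_v ∈ C_m` with `k`-block contexts `v`,
answered in every row `u` by a word of the `k`-block sum code `S_k = SumCodeWin (m·k) k 1`; the level-`(k+1)`
MASS BRACKET of a deviation `D` is `Σ_{u ∉ Z(K0)} d(δ_u, S_k) − Σ_{u ∈ Z(K0)} d(δ_u, S_k)` (`bracketK`).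

* statements VERBATIM: `distTo`, `ColsInCK`, `bracketK`, `MassIneqK`, `MassIneqAll`, `MassIneqKPays`,
  `RowLightK`, `LightMassK`, `MIChainFifteen`, `DisjointDom`, `DomPays`, `DomFive`, `DomSix`, `DomSeven`,
  `ExactMultSeven`, `exactMultSeven_of` (proof verbatim);
* `MassInequality.distTo_xorFold_le` — the distance to an `xor`-closed set containing `0` is subadditive
  over finite `xor`-sums;
* **`domPays : ∀ m, DomPays m`** — if every inside point `z` of `K0` has a set `R z` of outside points with
  `A z = ⊕_{u ∈ R z} A u` for all codewords `A`, pairwise disjoint, then for every deviation with codeword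
  columns `δ_z = ⊕_{u∈R z} δ_u`, so `d(δ_z, S_k) ≤ Σ_{u ∈ R z} d(δ_u, S_k)` and, the `R z` being disjoint
  subsets of the outside, `Σ_{z∈Z} d(δ_z,S_k) ≤ Σ_{u∉Z} d(δ_u,S_k)`: `MassIneqK m k K0` for every `k`.

WHAT THIS IS NOT: `MassIneqKPays` (the recursion) and the certificates `DomFive/Six/Seven` are NOT proved here
(`DomSeven` follows in `DominationSeven.lean`); MULT₁ at the paying block sizes (`m ≥ 14`) is OPEN; separation
NOT moved.
-/

noncomputable section

namespace Summit.QuantumAdvantage.AdviceFreeQNC0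

open Finset
open Literature.Computability.MetaComplexity Literature.Computability.MetaComplexity.Smolensky

namespace MassInequality

/-! ### Sketch13 v6b §MassInequalityK — statements VERBATIM -/

/-- Distance of a pattern to a set of patterns (`iInf` over the subtype; the sets used contain `0`).
(Sketch13 v6b, verbatim.) -/
noncomputable def distTo {n : ℕ} (S : ((Fin n → Bool) → Bool) → Prop) (r : (Fin n → Bool) → Bool) : ℕ :=
  ⨅ Q : {Q : (Fin n → Bool) → Bool // S Q}, pdist r Q.1

/-- Columns (indexed by `k`-block contexts) of a level-`(k+1)` deviation lie in `C_m`.  (Sketch13 v6b, verbatim.) -/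
def ColsInCK (m k : ℕ) (D : (Fin m → Bool) → (Fin (m * k) → Bool) → Bool) : Prop :=
  ∀ v, IsElim1 m (fun u => D u v)

/-- Level-`(k+1)` MASS BRACKET against the `k`-block sum code `S_k = SumCodeWin (m*k) k 1`.
(Sketch13 v6b, verbatim.) -/
noncomputable def bracketK (m k : ℕ) (K0 : (Fin m → Bool) → Bool)
    (D : (Fin m → Bool) → (Fin (m * k) → Bool) → Bool) : ℤ :=
  (∑ u ∈ univ.filter (fun u : Fin m → Bool => K0 u = true), (distTo (SumCodeWin (m * k) k 1) (D u) : ℤ)) -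
    ∑ u ∈ univ.filter (fun u : Fin m → Bool => K0 u = false), (distTo (SumCodeWin (m * k) k 1) (D u) : ℤ)

/-- **MI_k(m) at `K0`** (level `k+1`).  CONJECTURE for k ≥ 1 in general.  (Sketch13 v6b, verbatim.) -/
def MassIneqK (m k : ℕ) (K0 : (Fin m → Bool) → Bool) : Prop :=
  ∀ D, ColsInCK m k D → 0 ≤ bracketK m k K0 D

/-- MI at all levels, at every optimal symmetric codeword: the conjecture of record behind `TensorMultOneAt`.
(Sketch13 v6b, verbatim.) -/
def MassIneqAll (m : ℕ) : Prop := ∀ K0, IsOpt1 m K0 → IsSymPat K0 → ∀ k, 0 < k → MassIneqK m k K0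

/-- THE RECURSION (exact accounting at every level + induction; provable now, M/L):
MI_k at an optimal `K0` for all `k ≥ 1` ⇒ `W_k(m,1) ≥ (failCount K0)^k` for all `k`.  (Sketch13 v6b, verbatim;
NOT proved in this file.) -/
def MassIneqKPays (m : ℕ) : Prop :=
  ∀ K0, IsOpt1 m K0 → (∀ k, 0 < k → MassIneqK m k K0) →
    TensorMultAt m 1 ((failCount K0 : ℝ) / (2 : ℝ) ^ m)

/-- Level-`(k+1)` ROW-LIGHTNESS w.r.t. the sum code `S_k`.  (Sketch13 v6b, verbatim.) -/
def RowLightK (m k : ℕ) (D : (Fin m → Bool) → (Fin (m * k) → Bool) → Bool) : Prop :=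
  ∀ u, ∀ Q, SumCodeWin (m * k) k 1 Q → pwt Q ≠ 0 → 2 * pwt (D u) < pwt Q

/-- Light-deviation lemma at every level.  (Sketch13 v6b, verbatim; not proved here.) -/
def LightMassK (m : ℕ) : Prop :=
  ∀ K0, SC1At m K0 → ∀ k, 0 < k → ∀ D, ColsInCK m k D → RowLightK m k D → 0 ≤ bracketK m k K0 D

/-- The paying chain at `m = 15`.  (Sketch13 v6b, verbatim.) -/
def MIChainFifteen : Prop :=
  (∃ K0 : (Fin 15 → Bool) → Bool, IsOpt1 15 K0 ∧ IsSymPat K0 ∧ 2 ^ 15 < 4 * failCount K0) →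
    MassIneqAll 15 → MassIneqKPays 15 → TensorMultOneAt

/-! ### Sketch13 v6e §Domination — statements VERBATIM -/

/-- A disjoint domination certificate for `K0`: every inside point `z` gets a set `R z` of outside points with
`A z = ⊕_{u ∈ R z} A u` for every codeword `A` of the one-block code, the sets pairwise disjoint.
(Sketch13 v6e, verbatim.) -/
def DisjointDom (m : ℕ) (K0 : (Fin m → Bool) → Bool) : Prop :=
  ∃ R : (Fin m → Bool) → Finset (Fin m → Bool),
    (∀ z, K0 z = false → (∀ u ∈ R z, K0 u = true) ∧
        ∀ A, IsElim1 m A → (A z = true ↔ Odd ((R z).filter (fun u => A u = true)).card)) ∧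
    (∀ z z', K0 z = false → K0 z' = false → z ≠ z' → Disjoint (R z) (R z'))

/-- **DOMINATION PAYS**.  (Sketch13 v6e, verbatim; proved below as `domPays`.) -/
def DomPays (m : ℕ) : Prop := ∀ K0, DisjointDom m K0 → ∀ k, 0 < k → MassIneqK m k K0

/-- The certificate at `m = 5`.  (Sketch13 v6e, verbatim; not proved here.) -/
def DomFive : Prop := ∃ K0, IsOpt1 5 K0 ∧ failCount K0 = 2 ∧ DisjointDom 5 K0
/-- The certificate at `m = 6`.  (Sketch13 v6e, verbatim; not proved here.) -/
def DomSix : Prop := ∃ K0, IsOpt1 6 K0 ∧ failCount K0 = 8 ∧ DisjointDom 6 K0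
/-- The certificate at `m = 7`.  (Sketch13 v6e, verbatim; proved in `DominationSeven.lean`.) -/
def DomSeven : Prop := ∃ K0, IsOpt1 7 K0 ∧ failCount K0 = 16 ∧ DisjointDom 7 K0

/-- **EXACT MULTIPLICATIVITY AT m = 7** (target): `W_k(7,1) ≥ 16^k`.  (Sketch13 v6e, verbatim.) -/
def ExactMultSeven : Prop := TensorMultAt 7 1 ((16 : ℝ) / (2 : ℝ) ^ 7)

/-- The composition (Sketch13 v6e, proof verbatim). -/
theorem exactMultSeven_of (h1 : DomSeven) (h2 : DomPays 7) (h3 : MassIneqKPays 7) : ExactMultSeven := by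
  obtain ⟨K0, hopt, hfc, hdom⟩ := h1
  have hmi : ∀ k, 0 < k → MassIneqK 7 k K0 := h2 K0 hdom
  have := h3 K0 hopt hmi
  unfold ExactMultSeven
  have hc : ((failCount K0 : ℝ) / (2 : ℝ) ^ 7) = (16 : ℝ) / (2 : ℝ) ^ 7 := by rw [hfc]; norm_num
  rw [← hc]; exact this

/-! ### The distance to an `xor`-closed set is subadditive over `xor`-sums -/

variable {n : ℕ}

/-- `xor`-fold of a finite family of patterns: `(⊕_{a ∈ F} f a)(v) = [#{a ∈ F : f a v} odd]`. -/
def xorFold {α : Type*} (F : Finset α) (f : α → (Fin n → Bool) → Bool) : (Fin n → Bool) → Bool :=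
  fun v => decide (Odd ((F.filter fun a => f a v = true).card))

/-- The empty `xor`-fold is the zero pattern. -/
theorem xorFold_empty {α : Type*} (f : α → (Fin n → Bool) → Bool) : xorFold (∅ : Finset α) f = fun _ => false := by
  funext v; simp [xorFold]

/-- Inserting an element `xor`s its pattern in. -/
theorem xorFold_insert {α : Type*} [DecidableEq α] {F : Finset α} {a : α} (ha : a ∉ F)
    (f : α → (Fin n → Bool) → Bool) :
    xorFold (insert a F) f = fun v => xor (f a v) (xorFold F f v) := by
  funext v
  unfold xorFold
  rw [filter_insert]
  by_cases h : f a v = true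
  · rw [if_pos h, card_insert_of_notMem (fun h' => ha (mem_of_mem_filter a h')), h]
    simp only [Bool.true_xor]
    by_cases ho : Odd (#{a ∈ F | f a v = true})
    · have hn : ¬ Odd (#{a ∈ F | f a v = true} + 1) := by rw [Nat.odd_add_one]; exact not_not.2 ho
      simp [ho, hn]
    · have hy : Odd (#{a ∈ F | f a v = true} + 1) := by rw [Nat.odd_add_one]; exact ho
      simp [ho, hy]
  · rw [if_neg h]
    rw [Bool.not_eq_true] at h
    rw [h, Bool.false_xor]

/-- `distTo S r ≤ pdist r Q` for `Q ∈ S`. -/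
theorem distTo_le {S : ((Fin n → Bool) → Bool) → Prop} {r Q : (Fin n → Bool) → Bool} (hQ : S Q) :
    distTo S r ≤ pdist r Q :=
  ciInf_le' (fun Q : {Q : (Fin n → Bool) → Bool // S Q} => pdist r Q.1) ⟨Q, hQ⟩

/-- The infimum is attained (when `S` is inhabited). -/
theorem exists_eq_distTo {S : ((Fin n → Bool) → Bool) → Prop} (hS : ∃ Q, S Q) (r : (Fin n → Bool) → Bool) :
    ∃ Q, S Q ∧ pdist r Q = distTo S r := by
  obtain ⟨Q₀, hQ₀⟩ := hS
  haveI : Nonempty {Q : (Fin n → Bool) → Bool // S Q} := ⟨⟨Q₀, hQ₀⟩⟩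
  have hmem := Nat.sInf_mem (Set.range_nonempty (fun Q : {Q : (Fin n → Bool) → Bool // S Q} => pdist r Q.1))
  obtain ⟨Q, hQ⟩ := hmem
  exact ⟨Q.1, Q.2, hQ⟩

/-- Triangle for `pdist` under `xor`: `pdist (r ⊕ r') (Q ⊕ Q') ≤ pdist r Q + pdist r' Q'`. -/
theorem pdist_xor_xor_le (r r' Q Q' : (Fin n → Bool) → Bool) :
    pdist (fun v => xor (r v) (r' v)) (fun v => xor (Q v) (Q' v)) ≤ pdist r Q + pdist r' Q' := by
  classical
  unfold pdist
  refine le_trans (card_le_card fun v hv => ?_) (card_union_le _ _)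
  simp only [mem_filter, mem_univ, true_and, mem_union] at hv ⊢
  revert hv
  cases r v <;> cases r' v <;> cases Q v <;> cases Q' v <;> simp

/-- **Subadditivity** of `distTo S` for an `xor`-closed `S`. -/
theorem distTo_xor_le {S : ((Fin n → Bool) → Bool) → Prop} (hS : ∃ Q, S Q)
    (hxor : ∀ Q Q', S Q → S Q' → S (fun v => xor (Q v) (Q' v))) (r r' : (Fin n → Bool) → Bool) :
    distTo S (fun v => xor (r v) (r' v)) ≤ distTo S r + distTo S r' := by
  obtain ⟨Q, hQ, hQd⟩ := exists_eq_distTo hS r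
  obtain ⟨Q', hQ', hQ'd⟩ := exists_eq_distTo hS r'
  rw [← hQd, ← hQ'd]
  exact (distTo_le (hxor Q Q' hQ hQ')).trans (pdist_xor_xor_le r r' Q Q')

/-- `distTo S 0 = 0` when `0 ∈ S`. -/
theorem distTo_false {S : ((Fin n → Bool) → Bool) → Prop} (h0 : S (fun _ => false)) :
    distTo S (fun _ => false) = 0 := by
  apply Nat.eq_zero_of_le_zero
  refine (distTo_le h0).trans (le_of_eq ?_)
  unfold pdist; simp

/-- **Subadditivity over `xor`-folds**: `d(⊕_{a∈F} f a, S) ≤ Σ_{a∈F} d(f a, S)`. -/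
theorem distTo_xorFold_le {α : Type*} [DecidableEq α] {S : ((Fin n → Bool) → Bool) → Prop}
    (h0 : S (fun _ => false)) (hxor : ∀ Q Q', S Q → S Q' → S (fun v => xor (Q v) (Q' v)))
    (F : Finset α) (f : α → (Fin n → Bool) → Bool) :
    distTo S (xorFold F f) ≤ ∑ a ∈ F, distTo S (f a) := by
  induction F using Finset.induction_on with
  | empty => rw [xorFold_empty, distTo_false h0, sum_empty]
  | insert a F ha ih =>
    rw [xorFold_insert ha, sum_insert ha]
    exact (distTo_xor_le ⟨_, h0⟩ hxor _ _).trans (by omega)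

/-! ### Domination pays -/

/-- The `k`-block degree-`1` sum code contains `0` and is closed under `xor` (qn-prover's `TensorLPNorm`). -/
theorem sumCode_false (m k : ℕ) : SumCodeWin (m * k) k 1 (fun _ => false) :=
  (TensorLP.mem_code m k).1 (TensorLP.zero_mem_code m k)

/-- **`DomPays m` for every `m` — PROVED.** -/
theorem domPays (m : ℕ) : DomPays m := by
  classical
  intro K0 hdom k _ D hD
  obtain ⟨R, hR, hdisj⟩ := hdom
  set S : ((Fin (m * k) → Bool) → Bool) → Prop := SumCodeWin (m * k) k 1 with hS
  have hxor : ∀ Q Q', S Q → S Q' → S (fun v => xor (Q v) (Q' v)) := fun Q Q' hQ hQ' =>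
    TensorLP.sumCodeWin_xor hQ hQ'
  have h0 : S (fun _ => false) := sumCode_false m k
  set Z := univ.filter (fun u : Fin m → Bool => K0 u = false) with hZ
  set O := univ.filter (fun u : Fin m → Bool => K0 u = true) with hO
  -- inside rows are xor-folds of outside rows
  have hrow : ∀ z ∈ Z, D z = xorFold (R z) D := by
    intro z hz
    have hz' : K0 z = false := (mem_filter.1 hz).2
    funext v
    have hiff := (hR z hz').2 (fun u => D u v) (hD v)
    unfold xorFold
    by_cases h : D z v = true
    · rw [h]; exact (Bool.decide_iff _).2 (hiff.1 h) |>.symm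
    · rw [Bool.not_eq_true] at h
      rw [h]
      symm
      rw [decide_eq_false_iff_not]
      intro hodd
      rw [hiff.2 hodd] at h
      exact Bool.noConfusion h
  -- the inside mass is at most the outside mass
  have hle : ∑ z ∈ Z, distTo S (D z) ≤ ∑ u ∈ O, distTo S (D u) := by
    calc ∑ z ∈ Z, distTo S (D z) ≤ ∑ z ∈ Z, ∑ u ∈ R z, distTo S (D u) := by
          refine sum_le_sum fun z hz => ?_
          rw [hrow z hz]
          exact distTo_xorFold_le h0 hxor (R z) D
      _ = ∑ u ∈ Z.biUnion R, distTo S (D u) := by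
          rw [sum_biUnion]
          intro z hz z' hz' hne
          exact hdisj z z' (mem_filter.1 hz).2 (mem_filter.1 hz').2 hne
      _ ≤ ∑ u ∈ O, distTo S (D u) := by
          refine sum_le_sum_of_subset_of_nonneg (fun u hu => ?_) (fun _ _ _ => Nat.zero_le _)
          rw [mem_biUnion] at hu
          obtain ⟨z, hz, huz⟩ := hu
          exact mem_filter.2 ⟨mem_univ _, (hR z (mem_filter.1 hz).2).1 u huz⟩
  unfold bracketK
  have hcast : ((∑ z ∈ Z, distTo S (D z) : ℕ) : ℤ) ≤ ((∑ u ∈ O, distTo S (D u) : ℕ) : ℤ) := by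
    exact_mod_cast hle
  push_cast at hcast
  linarith

end MassInequality

end Summit.QuantumAdvantage.AdviceFreeQNC0
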